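import Summits.Ventures.HodgeRepro2.T5SU11ResolventOrigin
import Summits.Ventures.HodgeRepro2.T5SU11ResolventEigenfunction
import Summits.Ventures.HodgeRepro2.T5SU11ResolventGroundStateWeight

/-!
# The spherical transform of the decaying solution: `∫_0^∞ χ_λ(s) φ_{λ′}(a_s) sinh 2s ds = 1/(μ − μ′)`

Row 4xx's eigen-relation `G^I_λ φ_{λ′} = φ_{λ′}/(μ′ − μ)` (`1 < λ′ < λ`, and `λ′ = 1`) and row 625's boundary value
`G^I_λ g(t) → −∫_0^∞ χ_λ g sinh 2s ds` as `t → 0⁺` give, since `φ_{λ′}(a_0) = 1`, the closed form of the spherical transform of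
the decaying solution:

* `integral_sphDecay_mul_sph_eq` — **`∫_0^∞ χ_λ(s) φ_{λ′}(a_s) sinh 2s ds = 1/(μ − μ′) = 1/((λ − λ′)(λ + λ′ − 2))`** for `1 < λ′ < λ`;
* `integral_sphDecay_mul_sph_one_eq` — **`∫_0^∞ χ_λ(s) Ξ(s) sinh 2s ds = 1/(λ − 1)²`** (the case `λ′ = 1`): the `Ξ`-mass of the decaying
  solution is the sharp resolvent constant;
* `integral_sphDecay_mul_sph_pos` — the transform is positive.

In the spectral variable `μ′ = λ′(λ′ − 2)` the transform of `χ_λ` is the resolvent kernel `1/(μ − μ′)` of the spectral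
parameter — the spherical-transform picture of `(L − μ)⁻¹`. Nothing is claimed about (N).

Blind lane: Mathlib + the HodgeRepro2 prefix only; no sorry; axioms ⊆ {propext, Classical.choice,
Quot.sound}.
-/

namespace Summit.Ventures.HodgeRepro2.T5SU11SphericalTransformDecay

open Filter Topology MeasureTheory
open Set (Ioi Ioc)
open T5SU11Cartan T5SU11SphericalFunction T5SU11SphericalBounds T5SU11SphericalContinuous T5SU11SphericalDecay
  T5SU11RadialGreenImproper T5SU11RadialGreenImproperDecaySource T5SU11ResolventEigenfunction T5SU11ResolventOrigin
  T5SU11ResolventGroundStateWeight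

section measure

variable [MeasurableSpace Circle] [BorelSpace Circle]

variable {lam : ℝ} (hlam : 1 < lam)

include hlam in
/-- **THE SPHERICAL TRANSFORM OF THE DECAYING SOLUTION**: `∫_0^∞ χ_λ(s) φ_{λ′}(a_s) sinh 2s ds = 1/(μ − μ′)` for `1 < λ′ < λ`. -/
theorem integral_sphDecay_mul_sph_eq {lam' : ℝ} (h1 : 1 < lam') (h2 : lam' < lam) :
    ∫ s in Ioi 0, sphDecay lam s * sph lam' (hyp s) * Real.sinh (2 * s)
      = 1 / (lam * (lam - 2) - lam' * (lam' - 2)) := by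
  -- the class data of the source `φ_{λ′}`
  obtain ⟨Φ, hΦ0, hΦ⟩ := exists_abs_sph_le_one lam'
  obtain ⟨C, s₀, hC⟩ := exists_abs_sph_le_exp h1
  have hg : ContinuousOn (fun s => sph lam' (hyp s)) (Ioi 0) := (continuous_sph_hyp lam').continuousOn
  have hε : 2 - lam < 2 - lam' := by linarith
  have hA := integrableOn_sphDecay_mul_mul_sinh hlam hg hΦ hΦ0 hε hC
  -- the two limits of `G^I_λ φ_{λ′}` at the origin
  have hlim₁ := tendsto_greenSolI_nhdsGT_zero hlam hΦ hΦ0 hA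
  have hκ : lam' * (lam' - 2) - lam * (lam - 2) ≠ 0 := by
    have e : lam' * (lam' - 2) - lam * (lam - 2) = (lam' - lam) * (lam' + lam - 2) := by ring
    rw [e]
    exact mul_ne_zero (by linarith) (by linarith)
  have hφ : Tendsto (fun t => sph lam' (hyp t)) (𝓝[>] 0) (𝓝 1) := by
    have h : Tendsto (fun t => sph lam' (hyp t)) (𝓝[>] 0) (𝓝 (sph lam' (hyp 0))) :=
      ((continuous_sph_hyp lam').tendsto 0).mono_left (nhdsWithin_le_nhds (s := Ioi 0))
    rwa [T5SU11OneParameter.hyp_zero, sph_one] at h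
  have hlim₂ : Tendsto (greenSolI (fun t => sph lam (hyp t)) (sphDecay lam) (fun s => sph lam' (hyp s))) (𝓝[>] 0)
      (𝓝 (1 / (lam' * (lam' - 2) - lam * (lam - 2)))) := by
    have h := hφ.div_const (lam' * (lam' - 2) - lam * (lam - 2))
    refine h.congr' ?_
    filter_upwards [self_mem_nhdsWithin] with t ht
    exact (greenSolI_sph_eq hlam h1 h2 ht).symm
  have heq := tendsto_nhds_unique hlim₁ hlim₂
  have e : 1 / (lam * (lam - 2) - lam' * (lam' - 2)) = -(1 / (lam' * (lam' - 2) - lam * (lam - 2))) := by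
    have hκ' : lam * (lam - 2) - lam' * (lam' - 2) ≠ 0 := by
      intro h0
      apply hκ
      linarith
    field_simp
    ring
  rw [e, ← heq, neg_neg]

include hlam in
/-- **`∫_0^∞ χ_λ(s) Ξ(s) sinh 2s ds = 1/(λ − 1)²`**: the `Ξ`-mass of the decaying solution is the sharp resolvent constant. -/
theorem integral_sphDecay_mul_sph_one_eq :
    ∫ s in Ioi 0, sphDecay lam s * sph 1 (hyp s) * Real.sinh (2 * s) = 1 / (lam - 1) ^ 2 := by
  obtain ⟨hΞ, ⟨Φ, hΦ0, hΦ⟩, hεΞ, CΞ, hCΞ⟩ := sph_one_class hlam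
  have hA := integrableOn_sphDecay_mul_mul_sinh hlam hΞ hΦ hΦ0 hεΞ (fun s hs => hCΞ s hs)
  have hlim₁ := tendsto_greenSolI_nhdsGT_zero hlam hΦ hΦ0 hA
  have hφ : Tendsto (fun t => sph 1 (hyp t)) (𝓝[>] 0) (𝓝 1) := by
    have h : Tendsto (fun t => sph 1 (hyp t)) (𝓝[>] 0) (𝓝 (sph 1 (hyp 0))) :=
      ((continuous_sph_hyp 1).tendsto 0).mono_left (nhdsWithin_le_nhds (s := Ioi 0))
    rwa [T5SU11OneParameter.hyp_zero, sph_one] at h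
  have hlim₂ : Tendsto (greenSolI (fun t => sph lam (hyp t)) (sphDecay lam) (fun s => sph 1 (hyp s))) (𝓝[>] 0)
      (𝓝 (-(1 / (lam * (lam - 2) + 1)))) := by
    have h := (hφ.div_const (lam * (lam - 2) + 1)).neg
    refine h.congr' ?_
    filter_upwards [self_mem_nhdsWithin] with t ht
    exact (greenSolI_sph_one_eq hlam ht).symm
  have heq := tendsto_nhds_unique hlim₁ hlim₂
  have e : lam * (lam - 2) + 1 = (lam - 1) ^ 2 := by ring
  rw [e] at heq
  linarith

include hlam in
/-- The spherical transform of `χ_λ` is positive: `1/(μ − μ′) > 0` for `1 < λ′ < λ`. -/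
theorem integral_sphDecay_mul_sph_pos {lam' : ℝ} (h1 : 1 < lam') (h2 : lam' < lam) :
    0 < ∫ s in Ioi 0, sphDecay lam s * sph lam' (hyp s) * Real.sinh (2 * s) := by
  rw [integral_sphDecay_mul_sph_eq hlam h1 h2]
  have e : lam * (lam - 2) - lam' * (lam' - 2) = (lam - lam') * (lam + lam' - 2) := by ring
  rw [e]
  apply div_pos one_pos
  exact mul_pos (by linarith) (by linarith)

end measure

end Summit.Ventures.HodgeRepro2.T5SU11SphericalTransformDecay
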